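import Summits.ABC.IUTFork.Conditional.AbcOfCor312Slack
import Summits.ABC.IUTFork.Repair.RHOffSigmaDisplayTolerance
import HarnessLib

/-!
# The Σ-VARIANT, SHARP TOLERANCE OF RECORD (rh-lead ruling R11, 2026-08-26T22:05Z): the whole no-loss budget of [IUTchIV] Thm. 1.10
# Step (viii) is `Tol♯(P,l) := ((l+1)/4)·c♯(l)·(d*·l + η_prm)`, `c♯(l) := 20·(1 − 12/l²) − 84/9` — abc-iut-rh-typ-5's `τ = ((l+1)/4)·(2/3)·d*·l`
# (p470106) and this seat's `Tol = ((l+1)/4)·5·(d*·l + η_prm)` (p469667) are the shares `2/3` and `5` of the SAME budget, not disjoint slacks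

PROOF-ONLY sequel (no `def`, no new `Prop`, no instance, no notation) of `Conditional/AbcOfCor312Slack.lean` (this seat, p469667) and of
abc-iut-rh-typ-5's `Repair/RHOffSigmaDisplayTolerance.lean` (p470106, `RH.OffSigmaDisplay.displayTolerance`), written for referee rh2-ref-1 under
rh-lead ruling R11 («say whether the two slacks are the SAME rounding counted twice or DISJOINT»). TAKES NO SIDE on [IUTchIII] Cor. 3.12 or on any
author. S. Mochizuki, *Inter-universal Teichmüller theory IV* (RIMS Apr. 2020 = PRIMS **57** (2021)), Thm. 1.10 proof Step (viii) pp. 30–31 and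
last paragraph p. 31, Prop. 1.6 p. 16 [claim: Mochizuki2012, status: disputed].

THE ARITHMETIC, ONCE (notation of the core file; `E₁ := d*·l + η_prm`, `t := 1/l`, `l ≥ 7`, `d ≥ 1`). From the squeeze with `B_III + E`:
`(1/6)(1 − 12t²)·log(q) ≤ (1 + 12dt)·L + [2·log l + 56] + (20/3)·log(d*l)·π(d*l) + E/((l+1)/4)`; print bounds `(20/3)·log(d*l)·π(d*l) ≤ (80/9)·E₁`
(Prop. 1.6) and `2·log l + 56 ≤ (4/9)·E₁`, total `84/9` (print writes `28/3 ≤ 10`: FIRST rounding, room `2/3` — typ-5's `τ`); the display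
`(1/6)·log(q) ≤ (1 + 20dt)·L + 20·E₁` then needs only `coefficient ≤ 20·(1 − 12t²)` (print writes `(1 − 12/l²)⁻¹ ≤ 2`, i.e. uses `10 ≤ 20(1 − 12t²)`:
SECOND rounding, room `20(1 − 12t²) − 10 ≥ 250/49`). Hence the SHARP no-loss coefficient is `c♯(l) = 20·(1 − 12/l²) − 84/9` (`2544/441 ≈ 5.769`
at `l = 7`; `≈ 7.36` at `l = 11`; `→ 96/9`), and:
* `display_arith_sharp` — the last paragraph with a free coefficient `c ≤ 20·(1 − 12/l²)`;
* **`display_of_squeezeIII_slack_sharp`** — squeeze with `B_III + E`, `E ≤ ((l+1)/4)·c♯(l)·(d*·l + η_prm)` ⟹ `Cor22.Display P l η_prm`;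
* `display_of_squeezeIII_slack_of_le_sharp` — any coefficient `c₀ ≤ c♯(l)` (so `c₀ = 5`: p469667's `display_of_squeezeIII_slack`; `c₀ = 2/3`: the
  `η`-free `τ` of p470106, `display_of_squeezeIII_upTo_of_sharp` re-derives typ-5's theorem shape from the sharp one) — `five_le_sharpCoeff`,
  `two_thirds_le_sharpCoeff`;
* **`ABC_of_cor312Slack_sharp_of_hullRegime`** — [NUMΣ] weakened Corollary with slack `ε(P,l,T)` · [TOL♯] `ε ≤ ((l+1)/4)·c♯(l)·d*·l` (`η`-free) ·
  [CONE] `hreg` verbatim ⟹ `ABC` with print's constants (`Cor312Slack`-chain of the core file with the sharp display).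
ANSWER TO R11 (numbers): SAME budget, nested: `τ ⊂ Tol ⊂ Tol♯`; in `η`-free squeeze currency `τ = (1/6)·d*·l(l+1) = 92160·d_mod·l(l+1)`,
`Tol = (5/4)·d*·l(l+1) = 691200·d_mod·l(l+1)`, `Tol♯(l=7) = (2544/1764)·d*·l(l+1) ≈ 797450·d_mod·l(l+1)`, `Tol♯(l→∞) → (8/3)·d*·l(l+1) ≈ 1474560·d_mod·l(l+1)`.
The sum `τ + Tol = (17/12)·d*·l(l+1) ≤ Tol♯` holds (because `17/3 ≤ c♯(7)`), but as a COINCIDENCE of unused room, not by disjointness. Beyond `Tol♯`: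
constant loss via `η_prm` (this seat's `AbcOfCor312SlackBudget.lean`, `C_K ↦ C_K + 40K`), exponent loss for `θ·((l+1)/24)·log(q)`.
HONEST FRAMING: conditional bookkeeping of a disputed inequality's consequences; nothing asserts abc, Thm. 1.10 or Cor. 3.12; typed ≠ proved.
[cite: Mochizuki2012, IUTchIV Thm. 1.10 Steps (vii)–(viii) pp. 30–31; Prop. 1.6 p. 16; Cor. 2.2 (ii) pp. 41–48] [claim: Mochizuki2012, status: disputed]
-/

noncomputable section

namespace Summit.ABC.IUTFork.Conditional.Cor312Slack

open Literature.IUT.LogVolume Literature.IUT.HodgeTheaters Literature.NumberTheory.DiophantineGeometry.GenEll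
open Summit.ABC.ABC.Theorems NumberField IsDedekindDomain

variable {P : NFPoint} {l : ℕ}

/-! ## §1 The last paragraph with a free coefficient -/

/-- **The last paragraph of the proof of [IUTchIV] Thm. 1.10 (p. 31) with a FREE coefficient `c ≤ 20·(1 − 12/l²)`**: for `l ≥ 7`, `d ≥ 1`,
`L ≥ 0`, `Q > 0`, `E₁ > 0`, `(1/6)(1 − 12/l²)·Q ≤ (1 + 12d/l)·L + c·E₁` implies `(1/6)·Q ≤ (1 + 20d/l)·L + 20·E₁`
("`(1 − 12/l²)⁻¹·(1 + 12·d_mod/l) ≤ 1 + 20·d_mod/l`" and `c ≤ 20·(1 − 12/l²)`). [cite: Mochizuki2012, IUTchIV Thm. 1.10 proof, last paragraph p. 31]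
[claim: Mochizuki2012, status: disputed] -/
theorem display_arith_sharp {l d L Q E₁ c : ℝ} (hl7 : 7 ≤ l) (hd1 : 1 ≤ d) (hL : 0 ≤ L) (hQ : 0 < Q) (hE₁ : 0 < E₁)
    (hc : c ≤ 20 * (1 - 12 / l ^ 2)) (h : 1 / 6 * (1 - 12 / l ^ 2) * Q ≤ (1 + 12 * d / l) * L + c * E₁) :
    1 / 6 * Q ≤ (1 + 20 * d / l) * L + 20 * E₁ := by
  have hl0 : 0 < l := by linarith
  have _hQ := hQ
  set t : ℝ := 1 / l with ht
  have ht0 : 0 < t := by rw [ht]; positivity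
  have ht7 : t ≤ 1 / 7 := by rw [ht]; exact one_div_le_one_div_of_le (by norm_num) hl7
  have e1 : 12 * d / l = 12 * d * t := by rw [ht]; ring
  have e2 : 12 / l ^ 2 = 12 * t ^ 2 := by rw [ht]; field_simp
  have e3 : 20 * d / l = 20 * d * t := by rw [ht]; ring
  rw [e1, e2] at h
  rw [e2] at hc
  rw [e3]
  have ht2 : t ^ 2 ≤ 1 / 49 := by nlinarith
  have hden : 0 < 1 - 12 * t ^ 2 := by linarith
  have hstep : 1 / 6 * Q * (1 - 12 * t ^ 2) ≤ (1 + 12 * d * t) * L + c * E₁ := by linarith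
  have hc1 : (1 + 12 * d * t) ≤ (1 + 20 * d * t) * (1 - 12 * t ^ 2) := by
    have hA : 240 * d * t ^ 2 ≤ 240 * d * (1 / 49) := mul_le_mul_of_nonneg_left ht2 (by positivity)
    have hpos : 0 ≤ 8 * d - 12 * t - 240 * d * t ^ 2 := by linarith
    have hprod := mul_nonneg (le_of_lt ht0) hpos
    have expand : (1 + 20 * d * t) * (1 - 12 * t ^ 2) - (1 + 12 * d * t) = t * (8 * d - 12 * t - 240 * d * t ^ 2) := by ring
    linarith
  have key : (1 + 12 * d * t) * L + c * E₁ ≤ ((1 + 20 * d * t) * L + 20 * E₁) * (1 - 12 * t ^ 2) := by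
    have a1 := mul_le_mul_of_nonneg_right hc1 hL
    have a2 := mul_le_mul_of_nonneg_right hc hE₁.le
    have expand : ((1 + 20 * d * t) * L + 20 * E₁) * (1 - 12 * t ^ 2) =
        (1 + 20 * d * t) * (1 - 12 * t ^ 2) * L + 20 * (1 - 12 * t ^ 2) * E₁ := by ring
    rw [expand]
    linarith
  exact le_of_mul_le_mul_right (le_trans hstep key) hden

/-- `5 ≤ c♯(l) = 20·(1 − 12/l²) − 84/9` for `l ≥ 7` (`c♯(7) = 2544/441`): p469667's tolerance is a share of the sharp budget. [folklore] -/
theorem five_le_sharpCoeff {l : ℝ} (hl7 : 7 ≤ l) : (5 : ℝ) ≤ 20 * (1 - 12 / l ^ 2) - 84 / 9 := by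
  have hl0 : 0 < l := by linarith
  have h49 : 12 / l ^ 2 ≤ 12 / 49 := div_le_div_of_nonneg_left (by norm_num) (by norm_num) (by nlinarith)
  linarith

/-- `2/3 ≤ c♯(l)` for `l ≥ 7`: abc-iut-rh-typ-5's `τ` (p470106) is a share of the sharp budget. [folklore] -/
theorem two_thirds_le_sharpCoeff {l : ℝ} (hl7 : 7 ≤ l) : (2 / 3 : ℝ) ≤ 20 * (1 - 12 / l ^ 2) - 84 / 9 :=
  le_trans (by norm_num) (five_le_sharpCoeff hl7)

/-! ## §2 Step (viii) at a point with the SHARP tolerance -/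

/-- **[IUTchIV] Thm. 1.10 Step (viii) at a point of the `λ`-line, constant `B_III`, WITH THE SHARP TOLERANCE
`E ≤ ((l+1)/4)·(20·(1 − 12/l²) − 84/9)·(d*·l + η_prm)`** ⟹ print's display `Cor22.Display P l η_prm` UNCHANGED. All the room left by print's
two consecutive roundings of the coefficient of `(d*·l + η_prm)` — Step (viii) "`(20/3 + 1/3)·(4/3) = 28/3 ≤ 10`" (p. 31; honestly `80/9 + 4/9 =
84/9`) and the last paragraph "`(1 − 12/l²)⁻¹ ≤ 2`", i.e. `10 ≤ 20·(1 − 12/l²)` — is `c♯(l) := 20·(1 − 12/l²) − 84/9` (`= 2544/441 ≈ 5.769` at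
`l = 7`, increasing to `96/9 ≈ 10.67`); abc-iut-rh-typ-5's `τ(P,l) = ((l+1)/4)·(2/3)·d*·l` (p470106) is the share `10 − 28/3 = 2/3` of the first
rounding, this seat's `Tol = ((l+1)/4)·5·(…)` (p469667) the share `5`; both are instances of this one budget (`display_of_squeezeIII_slack_of_le_sharp`),
NOT disjoint slacks — their sum `17/3` happens to be `≤ c♯(7)` too, but `c♯` is the whole of it. Pure arithmetic; no side taken.
[cite: Mochizuki2012, IUTchIV Thm. 1.10 Steps (vii)–(viii) p. 30–31] [claim: Mochizuki2012, status: disputed] -/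
theorem display_of_squeezeIII_slack_sharp (hl : l.Prime) (h5 : 5 ≤ l) (hne : l ≠ 5) {η : ℝ} (hη : IsEtaPrm η) {E : ℝ}
    (hE : E ≤ ((l : ℝ) + 1) / 4 * ((20 * (1 - 12 / (l : ℝ) ^ 2) - 84 / 9) * ((((2 ^ 12 * 3 ^ 3 * 5 * Cor22.dmod P : ℕ) : ℝ)) * l + η)))
    (hineq : (((l : ℝ) + 1) / 24 - 1 / (2 * l)) * Cor22.logQAvoid P {2, l} ≤
      ((l : ℝ) + 1) / 4 *
          ((1 + 12 * (Cor22.dmod P : ℝ) / l) * (P.logDiff + Cor22.logCondAvoid P {2, l})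
            + 2 * Real.log l + 52
            + 20 / 3 * Real.log (((2 ^ 12 * 3 ^ 3 * 5 * Cor22.dmod P : ℕ) : ℝ) * (l : ℝ))
              * (Nat.primeCounting (2 ^ 12 * 3 ^ 3 * 5 * Cor22.dmod P * l) : ℝ))
        + E + ThetaVolumeInput.archLogTheta l) :
    Cor22.Display P l η := by
  have hLD : 0 ≤ P.logDiff := P.logDiff_nonneg
  have hLC : 0 ≤ Cor22.logCondAvoid P {2, l} := Cor22.logCondAvoid_nonneg P {2, l}
  have h7 : 7 ≤ l := seven_le_of_prime_of_ne_five hl h5 hne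
  have hl7 : (7 : ℝ) ≤ l := by exact_mod_cast h7
  have hl0 : (0 : ℝ) < l := by linarith
  have hd1 : (1 : ℝ) ≤ (Cor22.dmod P : ℝ) := by exact_mod_cast Cor22.dmod_pos P
  have hη0 : 0 < η := hη.1
  have hDst : (((2 ^ 12 * 3 ^ 3 * 5 * Cor22.dmod P : ℕ) : ℝ)) = 552960 * (Cor22.dmod P : ℝ) := by
    push_cast; ring
  have hDst0 : (0 : ℝ) < (((2 ^ 12 * 3 ^ 3 * 5 * Cor22.dmod P : ℕ) : ℝ)) := by rw [hDst]; positivity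
  have hE₁0 : 0 < (((2 ^ 12 * 3 ^ 3 * 5 * Cor22.dmod P : ℕ) : ℝ)) * l + η := by positivity
  by_cases hq : 0 < Cor22.logQAvoid P {2, l}
  swap
  · -- `log(q) ≤ 0`: the display is trivial (its right-hand side is nonnegative)
    have hq' : Cor22.logQAvoid P {2, l} ≤ 0 := not_lt.1 hq
    unfold Cor22.Display
    have h1 : 0 ≤ (1 + 20 * (Cor22.dmod P : ℝ) / l) * (P.logDiff + Cor22.logCondAvoid P {2, l}) := by positivity
    have h2 : 0 ≤ 20 * (2 ^ 12 * 3 ^ 3 * 5 * (Cor22.dmod P : ℝ) * l + η) := by positivity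
    linarith
  -- Prop. 1.6 (proved in the tree): `log(d*·l)·π(d*·l) ≤ (4/3)·(d*·l + η)`
  have hpnt : Real.log ((((2 ^ 12 * 3 ^ 3 * 5 * Cor22.dmod P : ℕ) : ℝ)) * (l : ℝ))
      * (Nat.primeCounting (2 ^ 12 * 3 ^ 3 * 5 * Cor22.dmod P * l) : ℝ) ≤
      4 / 3 * ((((2 ^ 12 * 3 ^ 3 * 5 * Cor22.dmod P : ℕ) : ℝ)) * l + η) := by
    have h0 : (0 : ℝ) ≤ (((2 ^ 12 * 3 ^ 3 * 5 * Cor22.dmod P : ℕ) : ℝ)) * l := by positivity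
    have h2 := log_mul_primeCounting_le_of_isEtaPrm hη h0
    rwa [show ⌊(((2 ^ 12 * 3 ^ 3 * 5 * Cor22.dmod P : ℕ) : ℝ)) * (l : ℝ)⌋₊ = 2 ^ 12 * 3 ^ 3 * 5 * Cor22.dmod P * l by
      exact_mod_cast Nat.floor_natCast (2 ^ 12 * 3 ^ 3 * 5 * Cor22.dmod P * l)] at h2
  -- from here on the constant `d* = 2^12·3^3·5·d_mod` (as a real number) is an opaque atom `N = 552960·d_mod`
  generalize hN : (((2 ^ 12 * 3 ^ 3 * 5 * Cor22.dmod P : ℕ) : ℝ)) = N at hE hineq hpnt hDst hDst0 hE₁0 ⊢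
  -- Step (viii)'s absorption `2·log l + 56 ≤ (4/9)·d*·l ≤ (4/9)·(d*·l + η)` (`log l ≤ l − 1`, `d* ≥ 552960`)
  have habs : 2 * Real.log (l : ℝ) + 56 ≤ 4 / 9 * (N * l + η) := by
    have hlogl : Real.log (l : ℝ) ≤ (l : ℝ) - 1 := Real.log_le_sub_one_of_pos hl0
    have hprod : (552960 : ℝ) * l ≤ N * l := by
      rw [hDst]
      exact mul_le_mul_of_nonneg_right (by nlinarith) hl0.le
    linarith
  -- Step (vii): `(l+5)/4·log π ≤ (l+1)/4·4`
  have harch : ThetaVolumeInput.archLogTheta l ≤ ((l : ℝ) + 1) / 4 * 4 := by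
    unfold ThetaVolumeInput.archLogTheta
    have hpi := log_pi_le_two
    have h1 : ((l : ℝ) + 5) / 4 * Real.log Real.pi ≤ ((l : ℝ) + 5) / 4 * 2 :=
      mul_le_mul_of_nonneg_left hpi (by positivity)
    linarith
  -- the prime-counting atom
  set W : ℝ := 20 / 3 * Real.log (N * (l : ℝ)) * (Nat.primeCounting (2 ^ 12 * 3 ^ 3 * 5 * Cor22.dmod P * l) : ℝ) with hW
  have hW' : W ≤ 20 / 3 * (4 / 3 * (N * l + η)) := by
    rw [hW, mul_assoc]
    exact mul_le_mul_of_nonneg_left hpnt (by norm_num)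
  have hc : (0 : ℝ) < ((l : ℝ) + 1) / 4 := by positivity
  -- the sharp coefficient
  set cS : ℝ := 20 * (1 - 12 / (l : ℝ) ^ 2) - 84 / 9 with hcS
  -- hypothesis + tolerance + Step (vii): everything to the right of `(l+1)/4·`
  have h1 : (((l : ℝ) + 1) / 24 - 1 / (2 * l)) * Cor22.logQAvoid P {2, l} ≤
      ((l : ℝ) + 1) / 4 * ((1 + 12 * (Cor22.dmod P : ℝ) / l) * (P.logDiff + Cor22.logCondAvoid P {2, l})
        + 2 * Real.log l + 52 + W + cS * (N * l + η) + 4) := by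
    have e : ((l : ℝ) + 1) / 4 * ((1 + 12 * (Cor22.dmod P : ℝ) / l) * (P.logDiff + Cor22.logCondAvoid P {2, l})
        + 2 * Real.log l + 52 + W + cS * (N * l + η) + 4) =
        ((l : ℝ) + 1) / 4 * ((1 + 12 * (Cor22.dmod P : ℝ) / l) * (P.logDiff + Cor22.logCondAvoid P {2, l})
          + 2 * Real.log l + 52 + W)
          + ((l : ℝ) + 1) / 4 * (cS * (N * l + η)) + ((l : ℝ) + 1) / 4 * 4 := by
      ring
    rw [e]
    linarith
  -- `(l+1)/4·(1/6)·(1 − 12/l²) ≤ (l+1)/24 − 1/(2l)`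
  have hcoef : ((l : ℝ) + 1) / 4 * (1 / 6 * (1 - 12 / (l : ℝ) ^ 2)) ≤ ((l : ℝ) + 1) / 24 - 1 / (2 * l) := by
    have hdiff : ((l : ℝ) + 1) / 24 - 1 / (2 * l) - ((l : ℝ) + 1) / 4 * (1 / 6 * (1 - 12 / (l : ℝ) ^ 2))
        = 1 / (2 * (l : ℝ) ^ 2) := by
      field_simp
      ring
    have hpos : (0 : ℝ) ≤ 1 / (2 * (l : ℝ) ^ 2) := by positivity
    linarith
  have h2 : ((l : ℝ) + 1) / 4 * (1 / 6 * (1 - 12 / (l : ℝ) ^ 2) * Cor22.logQAvoid P {2, l}) ≤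
      (((l : ℝ) + 1) / 24 - 1 / (2 * l)) * Cor22.logQAvoid P {2, l} := by
    calc ((l : ℝ) + 1) / 4 * (1 / 6 * (1 - 12 / (l : ℝ) ^ 2) * Cor22.logQAvoid P {2, l})
        = ((l : ℝ) + 1) / 4 * (1 / 6 * (1 - 12 / (l : ℝ) ^ 2)) * Cor22.logQAvoid P {2, l} := by ring
      _ ≤ (((l : ℝ) + 1) / 24 - 1 / (2 * l)) * Cor22.logQAvoid P {2, l} := mul_le_mul_of_nonneg_right hcoef hq.le
  have h3 : 1 / 6 * (1 - 12 / (l : ℝ) ^ 2) * Cor22.logQAvoid P {2, l} ≤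
      (1 + 12 * (Cor22.dmod P : ℝ) / l) * (P.logDiff + Cor22.logCondAvoid P {2, l})
        + 2 * Real.log l + 52 + W + cS * (N * l + η) + 4 :=
    le_of_mul_le_mul_left (le_trans h2 h1) hc
  -- collect: `(1/6)(1 − 12/l²)·log(q) ≤ (1 + 12d/l)·L + (84/9 + c♯)·(d*·l + η) = (1 + 12d/l)·L + 20(1 − 12/l²)·(d*·l + η)`
  have h4 : 1 / 6 * (1 - 12 / (l : ℝ) ^ 2) * Cor22.logQAvoid P {2, l} ≤
      (1 + 12 * (Cor22.dmod P : ℝ) / l) * (P.logDiff + Cor22.logCondAvoid P {2, l}) + (84 / 9 + cS) * (N * l + η) := by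
    have e : (84 / 9 + cS) * (N * l + η) = 84 / 9 * (N * l + η) + cS * (N * l + η) := by ring
    rw [e]
    linarith [hW', habs, h3]
  have hcoefS : 84 / 9 + cS ≤ 20 * (1 - 12 / (l : ℝ) ^ 2) := by rw [hcS]; linarith
  have h5' := display_arith_sharp hl7 hd1 (add_nonneg hLD hLC) hq hE₁0 hcoefS h4
  unfold Cor22.Display
  have e4 : 2 ^ 12 * 3 ^ 3 * 5 * (Cor22.dmod P : ℝ) * l + η = N * l + η := by
    rw [hDst]; ring
  rw [e4]
  exact h5'

/-- **Any share `c₀ ≤ c♯(l)` of the sharp budget**: the squeeze with `B_III + E`, `E ≤ ((l+1)/4)·c₀·(d*·l + η_prm)` ⟹ the display. With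
`c₀ = 5` this is p469667's `display_of_squeezeIII_slack`; with `c₀ = 2/3` (and `η_prm` dropped) abc-iut-rh-typ-5's `display_of_squeezeIII_upTo`.
[cite: Mochizuki2012, IUTchIV Thm. 1.10 Step (viii) p. 30–31] [claim: Mochizuki2012, status: disputed] -/
theorem display_of_squeezeIII_slack_of_le_sharp (hl : l.Prime) (h5 : 5 ≤ l) (hne : l ≠ 5) {η : ℝ} (hη : IsEtaPrm η) {c₀ E : ℝ}
    (hc₀ : c₀ ≤ 20 * (1 - 12 / (l : ℝ) ^ 2) - 84 / 9)
    (hE : E ≤ ((l : ℝ) + 1) / 4 * (c₀ * ((((2 ^ 12 * 3 ^ 3 * 5 * Cor22.dmod P : ℕ) : ℝ)) * l + η)))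
    (hineq : (((l : ℝ) + 1) / 24 - 1 / (2 * l)) * Cor22.logQAvoid P {2, l} ≤
      ((l : ℝ) + 1) / 4 *
          ((1 + 12 * (Cor22.dmod P : ℝ) / l) * (P.logDiff + Cor22.logCondAvoid P {2, l})
            + 2 * Real.log l + 52
            + 20 / 3 * Real.log (((2 ^ 12 * 3 ^ 3 * 5 * Cor22.dmod P : ℕ) : ℝ) * (l : ℝ))
              * (Nat.primeCounting (2 ^ 12 * 3 ^ 3 * 5 * Cor22.dmod P * l) : ℝ))
        + E + ThetaVolumeInput.archLogTheta l) :
    Cor22.Display P l η := by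
  refine display_of_squeezeIII_slack_sharp hl h5 hne hη (le_trans hE ?_) hineq
  have hd1 : (1 : ℝ) ≤ (Cor22.dmod P : ℝ) := by exact_mod_cast Cor22.dmod_pos P
  have hη0 : 0 < η := hη.1
  have hE₁ : (0 : ℝ) ≤ (((2 ^ 12 * 3 ^ 3 * 5 * Cor22.dmod P : ℕ) : ℝ)) * l + η := by positivity
  have hc : (0 : ℝ) ≤ ((l : ℝ) + 1) / 4 := by positivity
  exact mul_le_mul_of_nonneg_left (mul_le_mul_of_nonneg_right hc₀ hE₁) hc

/-- **abc-iut-rh-typ-5's theorem shape re-derived from the sharp budget** (same statement as `RH.OffSigmaDisplay.display_of_squeezeIII_upTo`,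
p470106: a slack `s ≤ τ(P,l) = displayTolerance P l` after the archimedean term): `τ = ((l+1)/4)·(2/3)·d*·l` is the share `c₀ = 2/3`. Kernel record
for rh-lead ruling R11 that the two tolerances draw on ONE budget. [cite: Mochizuki2012, IUTchIV Thm. 1.10 Step (viii) p. 30–31]
[claim: Mochizuki2012, status: disputed] -/
theorem display_of_squeezeIII_upTo_of_sharp (hl : l.Prime) (h5 : 5 ≤ l) (hne : l ≠ 5) {η : ℝ} (hη : IsEtaPrm η) {s : ℝ}
    (hs : s ≤ Summit.ABC.IUTFork.Repair.RH.OffSigmaDisplay.displayTolerance P l)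
    (hineq : (((l : ℝ) + 1) / 24 - 1 / (2 * l)) * Cor22.logQAvoid P {2, l} ≤
      ((l : ℝ) + 1) / 4 *
          ((1 + 12 * (Cor22.dmod P : ℝ) / l) * (P.logDiff + Cor22.logCondAvoid P {2, l})
            + 2 * Real.log l + 52
            + 20 / 3 * Real.log (((2 ^ 12 * 3 ^ 3 * 5 * Cor22.dmod P : ℕ) : ℝ) * (l : ℝ))
              * (Nat.primeCounting (2 ^ 12 * 3 ^ 3 * 5 * Cor22.dmod P * l) : ℝ))
        + ThetaVolumeInput.archLogTheta l + s) :
    Cor22.Display P l η := by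
  have hl7 : (7 : ℝ) ≤ l := by exact_mod_cast seven_le_of_prime_of_ne_five hl h5 hne
  have hη0 : 0 < η := hη.1
  refine display_of_squeezeIII_slack_of_le_sharp hl h5 hne hη (two_thirds_le_sharpCoeff hl7) (E := s) (le_trans hs ?_) (by linarith [hineq])
  rw [Summit.ABC.IUTFork.Repair.RH.OffSigmaDisplay.displayTolerance_eq]
  have hc : (0 : ℝ) ≤ ((l : ℝ) + 1) / 4 := by positivity
  have hD : (0 : ℝ) ≤ (((2 ^ 12 * 3 ^ 3 * 5 * Cor22.dmod P : ℕ) : ℝ)) * l := by positivity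
  exact mul_le_mul_of_nonneg_left (by nlinarith) hc

/-! ## §3 `ABC` with print's constants from the weakened Corollary with the SHARP `η`-free tolerance -/

/-- **`abc` from the weakened Corollary with slack `ε ≤ Tol♯(P,l) = ((l+1)/4)·(20·(1 − 12/l²) − 84/9)·d*_mod·l` (`η`-free sharp tolerance) and the
cone binder** — the `Cor312Slack` chain of the core file (`stub_thetaData`, `hullVolume_of_hullRegime`, slack squeeze, `thm110Legendre_of_pointwise`,
`Cor22.exists_partII_of_thm110Legendre`, `fullGaloisImage_holds`, `closes`, `genEllTwo_holds`, `JInvWlog_proof`) with `display_of_squeezeIII_slack_of_le_sharp`.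
CONDITIONAL on the assumption labels `h312ε`, `hTol`, `hreg`; no constant of the chain of record changes; no side taken.
[cite: Mochizuki2012, IUTchIV Cor. 2.2–2.3 pp. 41–55] [cite: Mochizuki2012, IUTchIII Cor. 3.12 p. 174] [claim: Mochizuki2012, status: disputed] -/
theorem ABC_of_cor312Slack_sharp_of_hullRegime
    (ε : ∀ (P : NFPoint) (l : ℕ), Cor22.ThetaVolumeDatumAt P l → ℝ)
    (h312ε : ∀ P : NFPoint, P ∈ UP → ∀ l : ℕ, l.Prime → 5 ≤ l →
      Cor22.AdmitsCore P → Cor22.CondP2 P l → Cor22.CondP5 P l → Cor22.CondP6 P l →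
      ∀ T : Cor22.ThetaVolumeDatumAt P l, T.negAbsLogQ ≤ T.negLogTheta + ε P l T)
    (hTol : ∀ P : NFPoint, P ∈ UP → ∀ l : ℕ, l.Prime → 5 ≤ l →
      Cor22.AdmitsCore P → Cor22.CondP2 P l → Cor22.CondP5 P l → Cor22.CondP6 P l →
      ∀ T : Cor22.ThetaVolumeDatumAt P l,
        ε P l T ≤ ((l : ℝ) + 1) / 4 * ((20 * (1 - 12 / (l : ℝ) ^ 2) - 84 / 9) * ((((2 ^ 12 * 3 ^ 3 * 5 * Cor22.dmod P : ℕ) : ℝ)) * l)))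
    (hreg : ∀ P : NFPoint, P ∈ UP → ∀ l : ℕ, l.Prime → 5 ≤ l →
      Cor22.AdmitsCore P → Cor22.CondP2 P l → Cor22.CondP5 P l → Cor22.CondP6 P l →
      ∀ T : Cor22.ThetaVolumeDatumAt P l,
        (letI := T.instFieldF; letI := T.instNumberFieldF; letI := T.instAlgebraF; letI := T.instFieldK
         letI := T.instNumberFieldK; letI := T.instAlgebraK; letI := T.instFieldFbar; letI := T.instAlgebraFbar
         letI := T.instAlgebraKFbar; letI := T.instIsElliptic
         ¬ (∀ p ∈ T.I.supportPrimes, ∀ v w : placesOver (fieldOfModuli T.E) p,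
            (Summit.ABC.IUTFork.DHData.ofInput T.I).logQloc p v = (Summit.ABC.IUTFork.DHData.ofInput T.I).logQloc p w)) →
        T.HullEstimateOf
          (((l : ℝ) + 1) / 4 *
            ((1 + 12 * (Cor22.dmod P : ℝ) / l) * (P.logDiff + Cor22.logCondAvoid P {2, l})
              + 2 * Real.log l + 52
              + 20 / 3 * Real.log (((2 ^ 12 * 3 ^ 3 * 5 * Cor22.dmod P : ℕ) : ℝ) * (l : ℝ))
                * (Nat.primeCounting (2 ^ 12 * 3 ^ 3 * 5 * Cor22.dmod P * l) : ℝ)))) :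
    _root_.ABC := by
  refine Summit.ABC.ABC.Theses.IUTThetaPilot.closes ?_ Summit.ABC.ABC.Theorems.genEllTwo_holds Summit.ABC.ABC.Theorems.JInvWlog_proof
  unfold Summit.ABC.ABC.Theses.IUTThetaPilot.ThetaPartII
  refine Cor22.exists_partII_of_thm110Legendre
    (ThetaPartIIDisplay.thm110Legendre_of_pointwise fun η hη P hP l hl h5 hne hcore hP2 hP5 h6 => ?_) Cor22.fullGaloisImage_holds
  obtain ⟨T⟩ := ThetaPartII.stub_thetaData P hP l hl h5 hcore hP2 hP5 h6
  have hU : P.InU := hP.1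
  have hl7 : (7 : ℝ) ≤ l := by exact_mod_cast seven_le_of_prime_of_ne_five hl h5 hne
  have hη0 : 0 < η := hη.1
  have hgap := logQAvoid_le_of_cor312Slack T hU (h312ε P hP l hl h5 hcore hP2 hP5 h6 T)
    (ThetaPartII.hullVolume_of_hullRegime hreg P hP l hl h5 hcore hP2 hP5 h6 T)
  refine display_of_squeezeIII_slack_of_le_sharp hl h5 hne hη le_rfl (le_trans (hTol P hP l hl h5 hcore hP2 hP5 h6 T) ?_) hgap
  have hc : (0 : ℝ) ≤ ((l : ℝ) + 1) / 4 := by positivity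
  have hcS : (0 : ℝ) ≤ 20 * (1 - 12 / (l : ℝ) ^ 2) - 84 / 9 := le_trans (by norm_num) (five_le_sharpCoeff hl7)
  exact mul_le_mul_of_nonneg_left (mul_le_mul_of_nonneg_left (by linarith) hcS) hc

end Summit.ABC.IUTFork.Conditional.Cor312Slack

end
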